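import Summits.Ventures.Crystal3D.Theorems.StickyWulffConstantGenericWallFloorShallowSeparation
import HarnessLib

/-!
# The deep-arrival tail: separation from ONE in-plane slot of grain 1 and a non-arriving ray of grain 2

HONEST FRAMING. Part of the venture `Summits/Ventures/Crystal3D` (cell `crystal3d-full`), helper `--supports` the
crux `GenericWallFloor` (stmt-Ventures-19480) of `route-Ventures-StickyWulffConstant`, registered line `WallLedgerG`,
open stub `stub_twoSlabAdhesion`; the UNIFORM lemma for the deep-arrival tail of the certificate
`ResidualOneSidedCoverage` (cf-p1 (lxvi); structural reading of 19480-p1's job j321228, 2026-08-29): the ascent ray of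
the terrace is periodic and mutual arrivals recur at every word length, but a pair presented by a reduced word `κ` is
SEPARATED — no chain frame of grain 1 launched from `u₁` is co-axial with a chain frame of grain 2 launched from `u₂` —
as soon as `u₁` lies IN the first mirror plane (`⟪u₁, κ.last⟫ = 0`) and NO chain frame of `(A₂, u₂)` is co-axial with the
base `A₁` itself («grain 2's ray from `u₂` is not a near-arrival»).  The second hypothesis is finite: it is decided by
the ray nodes of `(A₂, u₂)` at the two depths `|κ| − 1`, `|κ|` (`baseFar_of_depths`).

* `exists_rayData_last`, `exists_shallow_witness_last` — `exists_shallow_witness` keeping the grain-1 end letter.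
* `near_arrival_of_coaxial_base`, **`baseFar_of_depths`** — a chain frame of `(A₂, u₂)` co-axial with `A₁` sits at depth
  `|κ| − 1` or `|κ|`; contrapositive = the finite check.
* **`chainFrames_separated_of_inPlane_of_baseFar`**, **`stackFrames_separated_of_inPlane_of_baseFar`** — the tail lemma;
  the stack form is the separation clause of `SeparatedWideAt` / `SeparatedTiltAtCharge`.

WHAT THIS IS NOT: steepness, tilts and the flux floor of the separated ledger are the certificate's numeric data; not the
stub; F-C1 not moved.
-/

noncomputable section

namespace Summit.Ventures.Crystal3D.Theorems

open Summit.Ventures.Crystal3D Finset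
open Literature.MathematicalPhysics.StatisticalMechanics (fccStacking barlowStacking IsHaggSeq)
open scoped InnerProductSpace

/-- Ray data of a chain frame, with the LAST LETTER: `α = []` or its last (first-applied) letter is positive on `u`. -/
theorem exists_rayData_last {z : EuclideanSpace ℝ (Fin 3)} {A F : EuclideanSpace ℝ (Fin 3) ≃ₗᵢ[ℝ] EuclideanSpace ℝ (Fin 3)}
    {u : EuclideanSpace ℝ (Fin 3)} (hF : F ∈ chainFrames z A u) :
    ∃ α : List (EuclideanSpace ℝ (Fin 3)), F = wordFrame A α ∧
      (∀ μ ∈ α, ‖μ‖ = 1 ∧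
        ∀ w ∈ fccSlots, ⟪w, μ⟫_ℝ = 0 ∨ ⟪w, μ⟫_ℝ = Real.sqrt (2 / 3) ∨ ⟪w, μ⟫_ℝ = -Real.sqrt (2 / 3)) ∧
      List.IsChain (fun μ μ' => ⟪μ, μ'⟫_ℝ = 1 / 3 ∨ ⟪μ, μ'⟫_ℝ = -1 / 3) α ∧
      (α = [] ∨ ∃ μ, α.getLast? = some μ ∧ ⟪u, μ⟫_ℝ = Real.sqrt (2 / 3)) ∧
      ∀ d : ℕ, d ≤ α.length → ∃ G ∈ chainFrames z A u, G = wordFrame A (α.drop (α.length - d)) ∧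
        (d = 0 ∧ G = A ∨ ∃ n : EuclideanSpace ℝ (Fin 3), ‖n‖ = 1 ∧
          (∀ w ∈ fccSlots, ⟪A w, n⟫_ℝ = 0 ∨ ⟪A w, n⟫_ℝ = Real.sqrt (2 / 3) ∨ ⟪A w, n⟫_ℝ = -Real.sqrt (2 / 3)) ∧
          ⟪A u, n⟫_ℝ = Real.sqrt (2 / 3) ∧ 0 < d ∧ G = (forcedTop z ⟨A, u, 0⟩ n (d - 1)).frame) := by
  rcases hF with rfl | ⟨n, hn, hmenu, hpos, k, rfl⟩
  · refine ⟨[], rfl, fun μ hμ => by simp at hμ, List.isChain_nil, Or.inl rfl, fun d hd => ?_⟩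
    have hd0 : d = 0 := by simpa using hd
    subst hd0
    exact ⟨_, self_mem_chainFrames z _ u, rfl, Or.inl ⟨rfl, rfl⟩⟩
  · refine ⟨rayWord z ⟨A, u, 0⟩ n (k + 1), forcedTop_frame_eq_wordFrame z ⟨A, u, 0⟩ hn hmenu k,
      (rayWord_letters z ⟨A, u, 0⟩ hn hmenu k).1, rayWord_isChain z ⟨A, u, 0⟩ hn hmenu k,
      Or.inr ⟨A.symm n, getLast?_rayWord_succ z ⟨A, u, 0⟩ n k, by
        rw [← LinearIsometryEquiv.inner_map_map A, LinearIsometryEquiv.apply_symm_apply]; exact hpos⟩,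
      fun d hd => ?_⟩
    rw [length_rayWord] at hd
    obtain ⟨G, hG, hGw, hGd⟩ := exists_chainFrame_of_rayWord z hn hmenu hpos d
    refine ⟨G, hG, ?_, hGd.imp id fun h => ⟨n, hn, hmenu, hpos, h.1, h.2⟩⟩
    rw [hGw, length_rayWord, rayWord_drop z ⟨A, u, 0⟩ n (by omega : k + 1 - d ≤ k + 1),
      show k + 1 - (k + 1 - d) = d by omega]

/-- **Alignment is shallow, with the grain-1 end letter**: as `exists_shallow_witness`, and moreover when the grain-1
witness is not the base (`0 < d₁`) the LAST letter of `κ` is the first push normal of its ray: `⟪u₁, κ.last⟫ = ±√(2/3)`. -/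
theorem exists_shallow_witness_last {z₁ z₂ : EuclideanSpace ℝ (Fin 3)}
    {A₁ A₂ F₁ F₂ : EuclideanSpace ℝ (Fin 3) ≃ₗᵢ[ℝ] EuclideanSpace ℝ (Fin 3)} {u₁ u₂ : EuclideanSpace ℝ (Fin 3)}
    {κ : List (EuclideanSpace ℝ (Fin 3))}
    (hκl : ∀ μ ∈ κ, ‖μ‖ = 1 ∧
      ∀ w ∈ fccSlots, ⟪w, μ⟫_ℝ = 0 ∨ ⟪w, μ⟫_ℝ = Real.sqrt (2 / 3) ∨ ⟪w, μ⟫_ℝ = -Real.sqrt (2 / 3))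
    (hκc : List.IsChain (fun μ μ' => ⟪μ, μ'⟫_ℝ = 1 / 3 ∨ ⟪μ, μ'⟫_ℝ = -1 / 3) κ)
    (hA₂ : A₂ '' fccStacking 1 (Real.sqrt (2 / 3)) = (wordFrame A₁ κ) '' fccStacking 1 (Real.sqrt (2 / 3)))
    (hF₁ : F₁ ∈ chainFrames z₁ A₁ u₁) (hF₂ : F₂ ∈ chainFrames z₂ A₂ u₂)
    (hco : ∃ (L : EuclideanSpace ℝ (Fin 3) ≃ₗᵢ[ℝ] EuclideanSpace ℝ (Fin 3))
        (s₁ s₂ : EuclideanSpace ℝ (Fin 3)) (σ σ' : ℤ → ℤ), IsHaggSeq σ ∧ IsHaggSeq σ' ∧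
        F₁ '' fccStacking 1 (Real.sqrt (2 / 3)) ⊆ (fun p => L p + s₁) '' barlowStacking 1 (Real.sqrt (2 / 3)) σ ∧
        F₂ '' fccStacking 1 (Real.sqrt (2 / 3)) ⊆ (fun p => L p + s₂) '' barlowStacking 1 (Real.sqrt (2 / 3)) σ') :
    ∃ d₁ d₂ : ℕ, d₁ + d₂ ≤ κ.length ∧ κ.length ≤ d₁ + d₂ + 1 ∧
      (d₁ = 0 ∨ ∃ μ, κ.getLast? = some μ ∧ (⟪u₁, μ⟫_ℝ = Real.sqrt (2 / 3) ∨ ⟪u₁, μ⟫_ℝ = -Real.sqrt (2 / 3))) ∧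
      ∃ G₁ ∈ chainFrames z₁ A₁ u₁, ∃ G₂ ∈ chainFrames z₂ A₂ u₂,
        (d₁ = 0 ∧ G₁ = A₁ ∨ ∃ n₁ : EuclideanSpace ℝ (Fin 3), ‖n₁‖ = 1 ∧
          (∀ w ∈ fccSlots, ⟪A₁ w, n₁⟫_ℝ = 0 ∨ ⟪A₁ w, n₁⟫_ℝ = Real.sqrt (2 / 3) ∨ ⟪A₁ w, n₁⟫_ℝ = -Real.sqrt (2 / 3)) ∧
          ⟪A₁ u₁, n₁⟫_ℝ = Real.sqrt (2 / 3) ∧ 0 < d₁ ∧ G₁ = (forcedTop z₁ ⟨A₁, u₁, 0⟩ n₁ (d₁ - 1)).frame) ∧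
        (d₂ = 0 ∧ G₂ = A₂ ∨ ∃ n₂ : EuclideanSpace ℝ (Fin 3), ‖n₂‖ = 1 ∧
          (∀ w ∈ fccSlots, ⟪A₂ w, n₂⟫_ℝ = 0 ∨ ⟪A₂ w, n₂⟫_ℝ = Real.sqrt (2 / 3) ∨ ⟪A₂ w, n₂⟫_ℝ = -Real.sqrt (2 / 3)) ∧
          ⟪A₂ u₂, n₂⟫_ℝ = Real.sqrt (2 / 3) ∧ 0 < d₂ ∧ G₂ = (forcedTop z₂ ⟨A₂, u₂, 0⟩ n₂ (d₂ - 1)).frame) ∧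
        ∃ (L : EuclideanSpace ℝ (Fin 3) ≃ₗᵢ[ℝ] EuclideanSpace ℝ (Fin 3))
          (s₁ s₂ : EuclideanSpace ℝ (Fin 3)) (σ σ' : ℤ → ℤ), IsHaggSeq σ ∧ IsHaggSeq σ' ∧
          G₁ '' fccStacking 1 (Real.sqrt (2 / 3)) ⊆ (fun p => L p + s₁) '' barlowStacking 1 (Real.sqrt (2 / 3)) σ ∧
          G₂ '' fccStacking 1 (Real.sqrt (2 / 3)) ⊆ (fun p => L p + s₂) '' barlowStacking 1 (Real.sqrt (2 / 3)) σ' := by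
  obtain ⟨α, hF₁α, hαl, hαc, hαlast, hray₁⟩ := exists_rayData_last hF₁
  obtain ⟨β, hF₂β, hβl, hβc, -, hray₂⟩ := exists_rayData_last hF₂
  obtain ⟨S, γ, j, hS, hγ, hj, hγjl, hSx, himg⟩ := exists_word_of_coaxial_wordFrames hF₁α hF₂β hβl hco
  have hl : ∀ μ ∈ γ ++ j ++ α, ‖μ‖ = 1 ∧
      ∀ w ∈ fccSlots, ⟪w, μ⟫_ℝ = 0 ∨ ⟪w, μ⟫_ℝ = Real.sqrt (2 / 3) ∨ ⟪w, μ⟫_ℝ = -Real.sqrt (2 / 3) := by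
    intro μ hμ
    rcases List.mem_append.1 hμ with h | h
    · exact hγjl μ h
    · exact hαl μ h
  have hγc : List.IsChain (fun μ μ' => ⟪μ, μ'⟫_ℝ = 1 / 3 ∨ ⟪μ, μ'⟫_ℝ = -1 / 3) γ := by
    rw [hγ]; exact isChain_reverse_map S hβc
  have hjlen : j.length ≤ 1 := by
    rcases hj with rfl | ⟨m, -, -, rfl⟩ <;> simp
  have hγlen : γ.length = β.length := by rw [hγ, List.length_map, List.length_reverse]
  obtain ⟨p, q, j', hp, hq, hj', hρc, hwf, hpartial⟩ := junctions_structure A₁ γ j α hl hγc hαc hjlen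
  -- letters of the reduced form
  have hj'sub : ∀ μ ∈ j', μ ∈ j := by
    rcases hj' with rfl | rfl
    · intro μ hμ; simp at hμ
    · exact fun μ hμ => hμ
  have hρl : ∀ μ ∈ γ.take p ++ j' ++ α.drop q, ‖μ‖ = 1 ∧
      ∀ w ∈ fccSlots, ⟪w, μ⟫_ℝ = 0 ∨ ⟪w, μ⟫_ℝ = Real.sqrt (2 / 3) ∨ ⟪w, μ⟫_ℝ = -Real.sqrt (2 / 3) := by
    intro μ hμ
    rcases List.mem_append.1 hμ with h | h
    · rcases List.mem_append.1 h with h' | h'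
      · exact hl μ (by simp [List.mem_of_mem_take h'])
      · exact hl μ (by simp [hj'sub μ h'])
    · exact hl μ (by simp [List.mem_of_mem_drop h])
  -- rigidity: `κ` has the mirrors of the reduced form, in particular its length
  have himgs : (wordFrame A₁ κ : EuclideanSpace ℝ (Fin 3) → EuclideanSpace ℝ (Fin 3)) '' ↑fccSlots =
      (wordFrame A₁ (γ.take p ++ j' ++ α.drop q) : EuclideanSpace ℝ (Fin 3) → EuclideanSpace ℝ (Fin 3)) ''
        ↑fccSlots :=
    image_fccSlots_eq_of_image_fcc_eq _ _ (by rw [← hA₂, himg, hwf])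
  have hmap := map_reflection_eq_of_image_eq A₁ hκl hκc hρl hρc himgs
  have hj'len : j'.length ≤ 1 := by
    rcases hj' with rfl | rfl
    · simp
    · exact hjlen
  have hlen : κ.length = p + j'.length + (α.length - q) := by
    have h := congrArg List.length hmap
    rw [List.length_map, List.length_map, List.length_append, List.length_append, List.length_take,
      List.length_drop, min_eq_left hp] at h
    exact h
  refine ⟨α.length - q, p, by omega, by omega, ?_, ?_⟩
  · -- the grain-1 end letter
    by_cases hq0 : α.length - q = 0
    · exact Or.inl hq0
    · right
      rcases hαlast with rfl | ⟨μ₀, hμ₀, hμ₀u⟩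
      · simp at hq0
      · have hκne : κ ≠ [] := by rintro rfl; simp at hlen; omega
        obtain ⟨x, hx⟩ := Option.ne_none_iff_exists'.1 (mt List.getLast?_eq_none_iff.1 hκne)
        refine ⟨x, hx, ?_⟩
        have hdrop_ne : α.drop q ≠ [] := by rw [Ne, List.drop_eq_nil_iff]; omega
        have h1 := congrArg List.getLast? hmap
        rw [List.getLast?_map, List.getLast?_map, hx,
          List.getLast?_append_of_ne_nil _ hdrop_ne, List.getLast?_drop, if_neg (by omega), hμ₀,
          Option.map_some, Option.map_some, Option.some.injEq] at h1
        have hx1 := (hκl x (List.mem_of_getLast? hx)).1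
        have hμ1 := (hαl μ₀ (List.mem_of_getLast? hμ₀)).1
        rcases eq_or_eq_neg_of_reflection_eq hx1 hμ1 h1 with h | h
        · exact Or.inl (by rw [h, hμ₀u])
        · exact Or.inr (by rw [h, inner_neg_right, hμ₀u])
  -- the two tips
  obtain ⟨G₁, hG₁, hG₁w, hG₁d⟩ := hray₁ (α.length - q) (Nat.sub_le _ _)
  rw [show α.length - (α.length - q) = q by omega] at hG₁w
  obtain ⟨G₂, hG₂, hG₂w, hG₂d⟩ := hray₂ p (by rw [← hγlen]; exact hp)
  refine ⟨G₁, hG₁, G₂, hG₂, hG₁d, hG₂d, ?_⟩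
  -- the lattice of the grain-2 tip, transported: `G₂·Λ₀ = (wordFrame A₁ (j' ++ α.drop q))·Λ₀`
  set δ := β.drop (β.length - p) with hδ
  have hδl : ∀ μ ∈ δ, ‖μ‖ = 1 := fun μ hμ => (hβl μ (List.mem_of_mem_drop hμ)).1
  have hδlen : (δ.map S).length = p := by
    rw [List.length_map, hδ, List.length_drop]; omega
  have hγsplit : γ = (δ.map S).reverse ++ γ.drop p := by
    have h1 : γ = (δ.map S).reverse ++ ((β.take (β.length - p)).reverse).map S := by
      rw [hγ, ← List.map_reverse, ← List.map_append, ← List.reverse_append, List.take_append_drop]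
    have h2 : γ.drop p = ((β.take (β.length - p)).reverse).map S := by
      conv_lhs => rw [h1]
      rw [← hδlen, ← List.length_reverse, List.drop_left]
    rw [h2]; exact h1
  have hG₂img : G₂ '' fccStacking 1 (Real.sqrt (2 / 3)) =
      (wordFrame A₁ (j' ++ α.drop q)) '' fccStacking 1 (Real.sqrt (2 / 3)) := by
    rw [hG₂w, image_wordFrame_of_transport hS hSx δ hδl, ← wordFrame_append, ← hpartial]
    congr 2
    conv_lhs => rw [hγsplit]
    rw [show δ.map S ++ (((δ.map S).reverse ++ γ.drop p) ++ j ++ α) =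
        ((δ.map S).reverse).reverse ++ (δ.map S).reverse ++ (γ.drop p ++ j ++ α) by
      rw [List.reverse_reverse]; simp only [List.append_assoc]]
    rw [wordFrame_reverse_cancel]
  -- equal or twin
  refine coaxial_of_image_eq_or_twin G₁ G₂ ?_
  rcases hj' with rfl | rfl
  · left; rw [hG₂img, hG₁w, List.nil_append]
  · -- `j' = j`: empty or one junction letter
    rcases hj with rfl | ⟨m, -, -, rfl⟩
    · left; rw [hG₂img, hG₁w, List.nil_append]
    · right
      set x := F₁.symm m with hx
      obtain ⟨hx1, hxm⟩ := hl x (by simp)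
      refine ⟨G₁ x, by rw [LinearIsometryEquiv.norm_map, hx1], menu_frame_of_model G₁ hxm, ?_⟩
      rw [hG₂img, ← wordFrame_singleton_eq_twinFrame G₁ hx1, hG₁w, ← wordFrame_append]


/-- **A chain frame of grain 2 co-axial with the base of grain 1 is a near-arrival**: it can be taken at depth `|κ| − 1`
or `|κ|` on an admissible ray of `(A₂, u₂)` (or is the base `A₂` when `|κ| ≤ 1`). -/
theorem near_arrival_of_coaxial_base {z₂ : EuclideanSpace ℝ (Fin 3)}
    {A₁ A₂ F₂ : EuclideanSpace ℝ (Fin 3) ≃ₗᵢ[ℝ] EuclideanSpace ℝ (Fin 3)} {u₂ : EuclideanSpace ℝ (Fin 3)}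
    {κ : List (EuclideanSpace ℝ (Fin 3))}
    (hκl : ∀ μ ∈ κ, ‖μ‖ = 1 ∧
      ∀ w ∈ fccSlots, ⟪w, μ⟫_ℝ = 0 ∨ ⟪w, μ⟫_ℝ = Real.sqrt (2 / 3) ∨ ⟪w, μ⟫_ℝ = -Real.sqrt (2 / 3))
    (hκc : List.IsChain (fun μ μ' => ⟪μ, μ'⟫_ℝ = 1 / 3 ∨ ⟪μ, μ'⟫_ℝ = -1 / 3) κ)
    (hA₂ : A₂ '' fccStacking 1 (Real.sqrt (2 / 3)) = (wordFrame A₁ κ) '' fccStacking 1 (Real.sqrt (2 / 3)))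
    (hF₂ : F₂ ∈ chainFrames z₂ A₂ u₂)
    (hco : ∃ (L : EuclideanSpace ℝ (Fin 3) ≃ₗᵢ[ℝ] EuclideanSpace ℝ (Fin 3))
        (s₁ s₂ : EuclideanSpace ℝ (Fin 3)) (σ σ' : ℤ → ℤ), IsHaggSeq σ ∧ IsHaggSeq σ' ∧
        A₁ '' fccStacking 1 (Real.sqrt (2 / 3)) ⊆ (fun p => L p + s₁) '' barlowStacking 1 (Real.sqrt (2 / 3)) σ ∧
        F₂ '' fccStacking 1 (Real.sqrt (2 / 3)) ⊆ (fun p => L p + s₂) '' barlowStacking 1 (Real.sqrt (2 / 3)) σ') :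
    ∃ d₂ : ℕ, d₂ ≤ κ.length ∧ κ.length ≤ d₂ + 1 ∧ ∃ G₂ ∈ chainFrames z₂ A₂ u₂,
      (d₂ = 0 ∧ G₂ = A₂ ∨ ∃ n₂ : EuclideanSpace ℝ (Fin 3), ‖n₂‖ = 1 ∧
          (∀ w ∈ fccSlots, ⟪A₂ w, n₂⟫_ℝ = 0 ∨ ⟪A₂ w, n₂⟫_ℝ = Real.sqrt (2 / 3) ∨ ⟪A₂ w, n₂⟫_ℝ = -Real.sqrt (2 / 3)) ∧
          ⟪A₂ u₂, n₂⟫_ℝ = Real.sqrt (2 / 3) ∧ 0 < d₂ ∧ G₂ = (forcedTop z₂ ⟨A₂, u₂, 0⟩ n₂ (d₂ - 1)).frame) ∧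
      ∃ (L : EuclideanSpace ℝ (Fin 3) ≃ₗᵢ[ℝ] EuclideanSpace ℝ (Fin 3))
        (s₁ s₂ : EuclideanSpace ℝ (Fin 3)) (σ σ' : ℤ → ℤ), IsHaggSeq σ ∧ IsHaggSeq σ' ∧
        A₁ '' fccStacking 1 (Real.sqrt (2 / 3)) ⊆ (fun p => L p + s₁) '' barlowStacking 1 (Real.sqrt (2 / 3)) σ ∧
        G₂ '' fccStacking 1 (Real.sqrt (2 / 3)) ⊆ (fun p => L p + s₂) '' barlowStacking 1 (Real.sqrt (2 / 3)) σ' := by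
  -- the base is the only chain frame of `(A₁, 0)`: no first push normal is positive on the zero vector
  have hF₁ : A₁ ∈ chainFrames z₂ A₁ 0 := self_mem_chainFrames z₂ A₁ 0
  obtain ⟨d₁, d₂, hle, hge, G₁, -, G₂, hG₂, hG₁, hG₂d, hcoG⟩ := exists_shallow_witness hκl hκc hA₂ hF₁ hF₂ hco
  have hr : Real.sqrt (2 / 3) ≠ 0 := (Real.sqrt_pos.2 (by norm_num)).ne'
  rcases hG₁ with ⟨hd₁, rfl⟩ | ⟨n₁, -, -, hpos, -, -⟩
  · subst hd₁
    exact ⟨d₂, by omega, by omega, G₂, hG₂, hG₂d, hcoG⟩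
  · rw [map_zero, inner_zero_left] at hpos; exact absurd hpos.symm hr

/-- **The finite check for «no near-arrival»**: if the base `A₂` (when `|κ| ≤ 1`) and the ray nodes of `(A₂, u₂)` at the
depths `d₂` with `|κ| ≤ d₂ + 1`, `d₂ ≤ |κ|` are not co-axial with `A₁`, then NO chain frame of `(A₂, u₂)` is. -/
theorem baseFar_of_depths {z₂ : EuclideanSpace ℝ (Fin 3)}
    {A₁ A₂ : EuclideanSpace ℝ (Fin 3) ≃ₗᵢ[ℝ] EuclideanSpace ℝ (Fin 3)} {u₂ : EuclideanSpace ℝ (Fin 3)}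
    {κ : List (EuclideanSpace ℝ (Fin 3))}
    (hκl : ∀ μ ∈ κ, ‖μ‖ = 1 ∧
      ∀ w ∈ fccSlots, ⟪w, μ⟫_ℝ = 0 ∨ ⟪w, μ⟫_ℝ = Real.sqrt (2 / 3) ∨ ⟪w, μ⟫_ℝ = -Real.sqrt (2 / 3))
    (hκc : List.IsChain (fun μ μ' => ⟪μ, μ'⟫_ℝ = 1 / 3 ∨ ⟪μ, μ'⟫_ℝ = -1 / 3) κ)
    (hA₂ : A₂ '' fccStacking 1 (Real.sqrt (2 / 3)) = (wordFrame A₁ κ) '' fccStacking 1 (Real.sqrt (2 / 3)))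
    (hcheck : ∀ d₂ : ℕ, d₂ ≤ κ.length → κ.length ≤ d₂ + 1 →
      ∀ G₂ : EuclideanSpace ℝ (Fin 3) ≃ₗᵢ[ℝ] EuclideanSpace ℝ (Fin 3),
      (d₂ = 0 ∧ G₂ = A₂ ∨ ∃ n₂ : EuclideanSpace ℝ (Fin 3), ‖n₂‖ = 1 ∧
          (∀ w ∈ fccSlots, ⟪A₂ w, n₂⟫_ℝ = 0 ∨ ⟪A₂ w, n₂⟫_ℝ = Real.sqrt (2 / 3) ∨ ⟪A₂ w, n₂⟫_ℝ = -Real.sqrt (2 / 3)) ∧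
          ⟪A₂ u₂, n₂⟫_ℝ = Real.sqrt (2 / 3) ∧ 0 < d₂ ∧ G₂ = (forcedTop z₂ ⟨A₂, u₂, 0⟩ n₂ (d₂ - 1)).frame) →
      ¬ ∃ (L : EuclideanSpace ℝ (Fin 3) ≃ₗᵢ[ℝ] EuclideanSpace ℝ (Fin 3))
          (s₁ s₂ : EuclideanSpace ℝ (Fin 3)) (σ σ' : ℤ → ℤ), IsHaggSeq σ ∧ IsHaggSeq σ' ∧
          A₁ '' fccStacking 1 (Real.sqrt (2 / 3)) ⊆ (fun p => L p + s₁) '' barlowStacking 1 (Real.sqrt (2 / 3)) σ ∧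
          G₂ '' fccStacking 1 (Real.sqrt (2 / 3)) ⊆ (fun p => L p + s₂) '' barlowStacking 1 (Real.sqrt (2 / 3)) σ') :
    ∀ F₂ ∈ chainFrames z₂ A₂ u₂,
      ¬ ∃ (L : EuclideanSpace ℝ (Fin 3) ≃ₗᵢ[ℝ] EuclideanSpace ℝ (Fin 3))
          (s₁ s₂ : EuclideanSpace ℝ (Fin 3)) (σ σ' : ℤ → ℤ), IsHaggSeq σ ∧ IsHaggSeq σ' ∧
          A₁ '' fccStacking 1 (Real.sqrt (2 / 3)) ⊆ (fun p => L p + s₁) '' barlowStacking 1 (Real.sqrt (2 / 3)) σ ∧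
          F₂ '' fccStacking 1 (Real.sqrt (2 / 3)) ⊆ (fun p => L p + s₂) '' barlowStacking 1 (Real.sqrt (2 / 3)) σ' := by
  intro F₂ hF₂ hco
  obtain ⟨d₂, hle, hge, G₂, -, hG₂d, hcoG⟩ := near_arrival_of_coaxial_base hκl hκc hA₂ hF₂ hco
  exact hcheck d₂ hle hge G₂ hG₂d hcoG

/-- **The deep-arrival tail lemma (chain frames).**  If `u₁` lies in the first mirror plane of `κ` (`⟪u₁, κ.last⟫ = 0`)
and no chain frame of `(A₂, u₂)` is co-axial with `A₁`, then no chain frame of `(A₁, u₁)` (vertical `z₁`) is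
co-axial with a chain frame of `(A₂, u₂)` (vertical `z₂`). -/
theorem chainFrames_separated_of_inPlane_of_baseFar {z₁ z₂ : EuclideanSpace ℝ (Fin 3)}
    {A₁ A₂ : EuclideanSpace ℝ (Fin 3) ≃ₗᵢ[ℝ] EuclideanSpace ℝ (Fin 3)} {u₁ u₂ : EuclideanSpace ℝ (Fin 3)}
    {κ : List (EuclideanSpace ℝ (Fin 3))}
    (hκl : ∀ μ ∈ κ, ‖μ‖ = 1 ∧
      ∀ w ∈ fccSlots, ⟪w, μ⟫_ℝ = 0 ∨ ⟪w, μ⟫_ℝ = Real.sqrt (2 / 3) ∨ ⟪w, μ⟫_ℝ = -Real.sqrt (2 / 3))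
    (hκc : List.IsChain (fun μ μ' => ⟪μ, μ'⟫_ℝ = 1 / 3 ∨ ⟪μ, μ'⟫_ℝ = -1 / 3) κ)
    (hA₂ : A₂ '' fccStacking 1 (Real.sqrt (2 / 3)) = (wordFrame A₁ κ) '' fccStacking 1 (Real.sqrt (2 / 3)))
    (hin : ∀ μ, κ.getLast? = some μ → ⟪u₁, μ⟫_ℝ = 0)
    (hfar₂ : ∀ F₂ ∈ chainFrames z₂ A₂ u₂,
      ¬ ∃ (L : EuclideanSpace ℝ (Fin 3) ≃ₗᵢ[ℝ] EuclideanSpace ℝ (Fin 3))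
          (s₁ s₂ : EuclideanSpace ℝ (Fin 3)) (σ σ' : ℤ → ℤ), IsHaggSeq σ ∧ IsHaggSeq σ' ∧
          A₁ '' fccStacking 1 (Real.sqrt (2 / 3)) ⊆ (fun p => L p + s₁) '' barlowStacking 1 (Real.sqrt (2 / 3)) σ ∧
          F₂ '' fccStacking 1 (Real.sqrt (2 / 3)) ⊆ (fun p => L p + s₂) '' barlowStacking 1 (Real.sqrt (2 / 3)) σ') :
    ∀ F₁ ∈ chainFrames z₁ A₁ u₁, ∀ F₂ ∈ chainFrames z₂ A₂ u₂,
      ¬ ∃ (L : EuclideanSpace ℝ (Fin 3) ≃ₗᵢ[ℝ] EuclideanSpace ℝ (Fin 3))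
          (s₁ s₂ : EuclideanSpace ℝ (Fin 3)) (σ σ' : ℤ → ℤ), IsHaggSeq σ ∧ IsHaggSeq σ' ∧
          F₁ '' fccStacking 1 (Real.sqrt (2 / 3)) ⊆ (fun p => L p + s₁) '' barlowStacking 1 (Real.sqrt (2 / 3)) σ ∧
          F₂ '' fccStacking 1 (Real.sqrt (2 / 3)) ⊆ (fun p => L p + s₂) '' barlowStacking 1 (Real.sqrt (2 / 3)) σ' := by
  intro F₁ hF₁ F₂ hF₂ hco
  have hr : Real.sqrt (2 / 3) ≠ 0 := (Real.sqrt_pos.2 (by norm_num)).ne'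
  obtain ⟨d₁, d₂, -, -, hlast, G₁, -, G₂, hG₂, hG₁, -, hcoG⟩ :=
    exists_shallow_witness_last hκl hκc hA₂ hF₁ hF₂ hco
  rcases hlast with hd₁ | ⟨μ, hμ, hμu⟩
  · -- the grain-1 witness is the base: grain 2 near-arrives
    rcases hG₁ with ⟨-, rfl⟩ | ⟨n₁, -, -, -, hpos, -⟩
    · exact hfar₂ G₂ hG₂ hcoG
    · omega
  · -- the grain-1 witness is on a ray: `κ.last` is its first push normal, not in-plane
    have h0 := hin μ hμ
    rcases hμu with h | h <;> rw [h] at h0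
    · exact hr h0
    · exact hr (neg_eq_zero.1 h0)

/-- **The deep-arrival tail lemma (stack frames)** — the separation clause of `SeparatedWideAt` / `SeparatedTiltAtCharge`
for the slot pair `(u₁, u₂)`: `u₁` in the first mirror plane of `κ`, and the finite «no near-arrival» check for the rays
of `(A₂, u₂)`. -/
theorem stackFrames_separated_of_inPlane_of_baseFar {z₁ z₂ : EuclideanSpace ℝ (Fin 3)}
    {A₁ A₂ : EuclideanSpace ℝ (Fin 3) ≃ₗᵢ[ℝ] EuclideanSpace ℝ (Fin 3)} {u₁ u₂ : EuclideanSpace ℝ (Fin 3)}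
    {κ : List (EuclideanSpace ℝ (Fin 3))}
    (hκl : ∀ μ ∈ κ, ‖μ‖ = 1 ∧
      ∀ w ∈ fccSlots, ⟪w, μ⟫_ℝ = 0 ∨ ⟪w, μ⟫_ℝ = Real.sqrt (2 / 3) ∨ ⟪w, μ⟫_ℝ = -Real.sqrt (2 / 3))
    (hκc : List.IsChain (fun μ μ' => ⟪μ, μ'⟫_ℝ = 1 / 3 ∨ ⟪μ, μ'⟫_ℝ = -1 / 3) κ)
    (hA₂ : A₂ '' fccStacking 1 (Real.sqrt (2 / 3)) = (wordFrame A₁ κ) '' fccStacking 1 (Real.sqrt (2 / 3)))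
    (hin : ∀ μ, κ.getLast? = some μ → ⟪u₁, μ⟫_ℝ = 0)
    (hcheck : ∀ d₂ : ℕ, d₂ ≤ κ.length → κ.length ≤ d₂ + 1 →
      ∀ G₂ : EuclideanSpace ℝ (Fin 3) ≃ₗᵢ[ℝ] EuclideanSpace ℝ (Fin 3),
      (d₂ = 0 ∧ G₂ = A₂ ∨ ∃ n₂ : EuclideanSpace ℝ (Fin 3), ‖n₂‖ = 1 ∧
          (∀ w ∈ fccSlots, ⟪A₂ w, n₂⟫_ℝ = 0 ∨ ⟪A₂ w, n₂⟫_ℝ = Real.sqrt (2 / 3) ∨ ⟪A₂ w, n₂⟫_ℝ = -Real.sqrt (2 / 3)) ∧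
          ⟪A₂ u₂, n₂⟫_ℝ = Real.sqrt (2 / 3) ∧ 0 < d₂ ∧ G₂ = (forcedTop z₂ ⟨A₂, u₂, 0⟩ n₂ (d₂ - 1)).frame) →
      ¬ ∃ (L : EuclideanSpace ℝ (Fin 3) ≃ₗᵢ[ℝ] EuclideanSpace ℝ (Fin 3))
          (s₁ s₂ : EuclideanSpace ℝ (Fin 3)) (σ σ' : ℤ → ℤ), IsHaggSeq σ ∧ IsHaggSeq σ' ∧
          A₁ '' fccStacking 1 (Real.sqrt (2 / 3)) ⊆ (fun p => L p + s₁) '' barlowStacking 1 (Real.sqrt (2 / 3)) σ ∧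
          G₂ '' fccStacking 1 (Real.sqrt (2 / 3)) ⊆ (fun p => L p + s₂) '' barlowStacking 1 (Real.sqrt (2 / 3)) σ') :
    ∀ stk₁ : List WalkEntry, StackSound z₁ stk₁ → StackWF z₁ stk₁ → stk₁.getLast? = some ⟨A₁, u₁, 0⟩ →
    ∀ e₁ ∈ stk₁,
    ∀ stk₂ : List WalkEntry, StackSound z₂ stk₂ → StackWF z₂ stk₂ → stk₂.getLast? = some ⟨A₂, u₂, 0⟩ →
    ∀ e₂ ∈ stk₂,
      ¬ ∃ (L : EuclideanSpace ℝ (Fin 3) ≃ₗᵢ[ℝ] EuclideanSpace ℝ (Fin 3)) (s₁ s₂ : EuclideanSpace ℝ (Fin 3))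
          (σ σ' : ℤ → ℤ), IsHaggSeq σ ∧ IsHaggSeq σ' ∧
        e₁.frame '' fccStacking 1 (Real.sqrt (2 / 3)) ⊆
          (fun p => L p + s₁) '' barlowStacking 1 (Real.sqrt (2 / 3)) σ ∧
        e₂.frame '' fccStacking 1 (Real.sqrt (2 / 3)) ⊆
          (fun p => L p + s₂) '' barlowStacking 1 (Real.sqrt (2 / 3)) σ' :=
  fun _ hS₁ hW₁ hl₁ e₁ he₁ _ hS₂ hW₂ hl₂ e₂ he₂ =>
    chainFrames_separated_of_inPlane_of_baseFar hκl hκc hA₂ hin (baseFar_of_depths hκl hκc hA₂ hcheck)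
      e₁.frame (frame_mem_chainFrames_of_stack hS₁ hW₁ hl₁ e₁ he₁)
      e₂.frame (frame_mem_chainFrames_of_stack hS₂ hW₂ hl₂ e₂ he₂)

end Summit.Ventures.Crystal3D.Theorems

end
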